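import Summits.Schanuel.Schanuel.Theses.RootDecomp1
import Summits.Schanuel.Schanuel.Theses.RootDecomp1C
import Summits.Schanuel.Schanuel.Theorems.RootDecomp1EssentialInEcl
import Summits.Schanuel.Schanuel.Theorems.RootDecomp1DefectSplit
import Summits.Schanuel.Schanuel.Theorems.RootDecomp1EntanglementSplit
import Summits.Schanuel.Schanuel.Theorems.RootDecomp1CAxisReductionNormalForm
import Literature.NumberTheory.Transcendental.SchanuelEclEmptyProofs
import Literature.NumberTheory.Transcendental.EclPregeometryProofs
import Summits.Schanuel.Schanuel.Theorems.RootDecomp1EAnchorToolkit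

/-!
# Rigidity of the tight atom under one-defect Schanuel (route-Schanuel-RootDecomp1, lens-1 round 8 «RigidityLayer» — tree port) — part 1 (§2–§4: toolkit, core lemma, conjugation restriction)

Kernel theorems about the items of `route-Schanuel-RootDecomp1` (no item is restated; every hypothesis is a
live item BY NAME or plain data):

* `span_le_of_atom_of_failure` — under `DefectOneSchanuel` (B, 25020) the ℚ-span of a TIGHT ATOM (ℚ-l.i.,
  `trdeg ℚ(z,e^z) < n`, span-minimal in the span-local sense of items 29645 / 30352 / 30353) lies inside the span of
  every failing ℚ-l.i. tuple; `atom_span_unique`; `conj_mem_span_of_atom` (the atom is conjugation-stable);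
  `exists_atom_of_failure` (no hypothesis); `real_or_unitary_of_defectOne : B → 1C.RealSchanuel ∨ 1C.UnitarySchanuel`.
* span invariance of `trdeg ℚ(z,e^z)`, `ℚ(z)`, `trdeg ℚ(e^z)` under a ℚ-change of basis (`*_of_basis_change`).
* `entangled_of_axisRestricted` — `B → L → Q → U⊥ → (30352 restricted to AXIS tuples) → 30352`
  (`EntangledSaturatedEssentialSchanuel`), the restricted statement spelled out as a hypothesis (it is the lens's
  proposed round-8 residual `AxisEntangledSaturatedEssentialSchanuel`, not an item yet); `entangled_of_conjStableRestricted`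
  likewise for the conjugation-stable restriction.

Computation credit: the submodular count is lens-2 gen-0 `DefectLattice.closes_lattice` / lens-5 gen-2
`firstFailureConjStable_of_defectOne` (HOME files, global-minimality forms); the span-local form, the transfer and the
cross-route disjunction are lens-1 gen 8.  `--supports stmt-Schanuel-30352`.
-/

set_option linter.dupNamespace false

noncomputable section

namespace Summit.Schanuel.Schanuel.Theorems.RootDecomp1AtomRigidity

open Complex IntermediateField
open scoped BigOperators Cardinal ComplexConjugate
open Summit.Schanuel.Schanuel.Theses.RootDecomp1 (SchanuelTwo EssentialCounterexamplesInEcl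
  DefectOneSchanuel LinearSchanuel QuadraticSchanuel RationalImageSchanuel
  NonrationalSaturatedEssentialSchanuel EntangledSaturatedEssentialSchanuel
  DisjointSaturatedEssentialSchanuel NonrationalSaturatedEssentialSchanuelGlue)
open Summit.Schanuel.Schanuel.Theorems.RootDecomp1DefectSplit (trdeg_adjoin_le_of_isAlgebraic isAlgebraic_of_mem_gens)
open Summit.Schanuel.Schanuel.Theorems.RootDecomp1EAnchor (isAlgebraic_of_le trdeg_adjoin_sum_le_union
  trdeg_adjoin_union_le_sum)
open Summit.Schanuel.Schanuel.Theorems.RootDecomp1EntanglementSplit (nonrationalSaturatedEssentialSchanuelGlue_holds)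
open Summit.Schanuel.Schanuel.Theorems.RootDecomp1EssentialInEcl (essentialCounterexamplesInEcl_holds)
open Summit.Schanuel.Schanuel.Theorems.RootDecomp1CAxisReduction (exists_axis_tuple_of_conj_stable)
open Literature.NumberTheory.Transcendental (exists_nsmul_mem_span_int mem_adjoin_of_mem_span_int
  trdeg_adjoin_le_of_le Kirby2010_ecl_isExpSubfield_holds)

/-! ## §2  Toolkit: towers, conjugation, integer spans -/

/-- The `ℤ`-span of a family lies in the field generated by the family. -/
theorem mem_adjoin_range_of_mem_span_int {ι : Type*} (x : ι → ℂ) {a : ℂ}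
    (ha : a ∈ Submodule.span ℤ (Set.range x)) : a ∈ adjoin ℚ (Set.range x) := by
  induction ha using Submodule.span_induction with
  | mem b hb => exact subset_adjoin ℚ _ hb
  | zero => exact zero_mem _
  | add b c _ _ hb hc => exact add_mem hb hc
  | smul m b _ hb => exact zsmul_mem hb m

/-- … and the exponential of an element of the `ℤ`-span lies in the field generated by the exponentials. -/
theorem exp_mem_adjoin_exp_of_mem_span_int {ι : Type*} (x : ι → ℂ) {a : ℂ}
    (ha : a ∈ Submodule.span ℤ (Set.range x)) : Complex.exp a ∈ adjoin ℚ (Set.range (Complex.exp ∘ x)) := by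
  induction ha using Submodule.span_induction with
  | mem b hb =>
    obtain ⟨i, rfl⟩ := hb
    exact subset_adjoin ℚ _ ⟨i, rfl⟩
  | zero => rw [Complex.exp_zero]; exact one_mem _
  | add b c _ _ hb hc => rw [Complex.exp_add]; exact mul_mem hb hc
  | smul m b _ hb =>
    rw [zsmul_eq_mul, Complex.exp_int_mul]
    exact zpow_mem hb m

/-- Division by a nonzero natural number inside an intermediate field. -/
theorem mem_of_natCast_mul_mem {F : IntermediateField ℚ ℂ} {N : ℕ} (hN : N ≠ 0) {a : ℂ}
    (h : (N : ℂ) * a ∈ F) : a ∈ F := by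
  have hN' : (N : ℂ) ≠ 0 := Nat.cast_ne_zero.mpr hN
  have : a = (N : ℂ)⁻¹ * ((N : ℂ) * a) := by rw [← mul_assoc, inv_mul_cancel₀ hN', one_mul]
  rw [this]
  exact mul_mem (inv_mem (_root_.natCast_mem F N)) h

/-- Complex conjugation transports `ℚ(x, eˣ)` onto `ℚ(x̄, e^{x̄})`: equal transcendence degrees. -/
theorem trdeg_conj_eq {n : ℕ} (x : Fin n → ℂ) :
    Algebra.trdeg ℚ ↥(adjoin ℚ (Set.range (fun j => conj (x j)) ∪ Set.range (Complex.exp ∘ fun j => conj (x j)))) =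
      Algebra.trdeg ℚ ↥(adjoin ℚ (Set.range x ∪ Set.range (Complex.exp ∘ x))) := by
  let σ : ℂ →ₐ[ℚ] ℂ := (starRingEnd ℂ).toRatAlgHom
  have σ_apply : ∀ z, σ z = conj z := fun z => rfl
  set Sx : Set ℂ := Set.range x ∪ Set.range (Complex.exp ∘ x) with hSx
  set Sxc : Set ℂ := Set.range (fun j => conj (x j)) ∪ Set.range (Complex.exp ∘ fun j => conj (x j)) with hSxc
  have hset : (⇑σ) '' Sx = Sxc := by
    rw [hSx, hSxc, Set.image_union, ← Set.range_comp, ← Set.range_comp]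
    have e1 : (⇑σ ∘ x) = fun j => conj (x j) := by funext j; simp [σ_apply]
    have e2 : (⇑σ ∘ (Complex.exp ∘ x)) = Complex.exp ∘ fun j => conj (x j) := by
      funext j; simp [σ_apply, Complex.exp_conj]
    rw [e1, e2]
  have hmap : (adjoin ℚ Sx).map σ = adjoin ℚ Sxc := by rw [adjoin_map, hset]
  exact (((equivMap (adjoin ℚ Sx) σ).trans (equivOfEq hmap)).trdeg_eq).symm

/-- The conjugate of a ℚ-linearly independent tuple is ℚ-linearly independent. -/
theorem linearIndependent_conj {n : ℕ} {x : Fin n → ℂ} (hx : LinearIndependent ℚ x) :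
    LinearIndependent ℚ (fun j => conj (x j)) :=
  hx.map' ((starRingEnd ℂ).toRatAlgHom).toLinearMap (LinearMap.ker_eq_bot.mpr (starRingEnd ℂ).injective)

/-! ## §3  THE CORE LEMMA: under `B`, a tight atom lies inside every failure -/

/-- **Core lemma (rigidity of the atom under one-defect Schanuel).**  Let `z` be a TIGHT ATOM — ℚ-l.i. of length
`n`, `trdeg ℚ(z, e^z) < n`, and SPAN-MINIMAL (every shorter ℚ-l.i. tuple inside `span_ℚ z` satisfies Schanuel) — and
let `y` be ANY failing ℚ-l.i. tuple (`trdeg ℚ(y, e^y) < m`).  If `B` holds then `span_ℚ z ⊆ span_ℚ y`.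
Proof: with `V = span z`, `W = span y`, `U = V ∩ W`, `P = V + W`: if `V ⊄ W` then `dim U < n`, so span-minimality
gives `trdeg(U) ≥ dim U`; `B` gives `trdeg(P) ≥ dim P − 1 = n + m − dim U − 1`; submodularity
`trdeg(P) + trdeg(U) ≤ trdeg(V) + trdeg(W) ≤ (n − 1) + (m − 1)` — contradiction. -/
theorem span_le_of_atom_of_failure (hD : DefectOneSchanuel) {n m : ℕ} {z : Fin n → ℂ} {y : Fin m → ℂ}
    (hz : LinearIndependent ℚ z)
    (hztr : Algebra.trdeg ℚ ↥(adjoin ℚ (Set.range z ∪ Set.range (Complex.exp ∘ z))) < (n : Cardinal))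
    (hmin : ∀ (k : ℕ), k < n → ∀ (w : Fin k → ℂ), LinearIndependent ℚ w →
      (∀ i, w i ∈ Submodule.span ℚ (Set.range z)) →
      (k : Cardinal) ≤ Algebra.trdeg ℚ ↥(adjoin ℚ (Set.range w ∪ Set.range (Complex.exp ∘ w))))
    (hy : LinearIndependent ℚ y)
    (hytr : Algebra.trdeg ℚ ↥(adjoin ℚ (Set.range y ∪ Set.range (Complex.exp ∘ y))) < (m : Cardinal)) :
    Submodule.span ℚ (Set.range z) ≤ Submodule.span ℚ (Set.range y) := by
  classical
  by_contra hnle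
  obtain ⟨x₀, hx₀V, hx₀W⟩ := SetLike.not_le_iff_exists.mp hnle
  set V : Submodule ℚ ℂ := Submodule.span ℚ (Set.range z) with hV
  set W : Submodule ℚ ℂ := Submodule.span ℚ (Set.range y) with hW
  haveI : FiniteDimensional ℚ V := FiniteDimensional.span_of_finite ℚ (Set.finite_range z)
  haveI : FiniteDimensional ℚ W := FiniteDimensional.span_of_finite ℚ (Set.finite_range y)
  have hVn : Module.finrank ℚ V = n := by rw [hV, finrank_span_eq_card hz, Fintype.card_fin]
  have hWm : Module.finrank ℚ W = m := by rw [hW, finrank_span_eq_card hy, Fintype.card_fin]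
  haveI : FiniteDimensional ℚ ↥(V ⊓ W) := Submodule.finiteDimensional_of_le inf_le_left
  have hx₀U : x₀ ∉ V ⊓ W := fun h => hx₀W h.2
  have hUlt : V ⊓ W < V := SetLike.lt_iff_le_and_exists.mpr ⟨inf_le_left, x₀, hx₀V, hx₀U⟩
  have hk_lt : Module.finrank ℚ ↥(V ⊓ W) < n := by
    rw [← hVn]; exact Submodule.finrank_lt_finrank_of_lt hUlt
  have hcount : Module.finrank ℚ ↥(V ⊔ W) + Module.finrank ℚ ↥(V ⊓ W) = n + m := by
    rw [Submodule.finrank_sup_add_finrank_inf_eq V W, hVn, hWm]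
  -- the concatenated family spans `V ⊔ W`
  let s : Fin n ⊕ Fin m → ℂ := Sum.elim z y
  have hs_range : Set.range s = Set.range z ∪ Set.range y := Set.Sum.elim_range z y
  have hP : Submodule.span ℚ (Set.range s) = V ⊔ W := by rw [hs_range, Submodule.span_union]
  -- bases of `V ⊔ W` and `V ⊓ W`
  set p := Module.finrank ℚ ↥(V ⊔ W) with hp_def
  set k := Module.finrank ℚ ↥(V ⊓ W) with hk_def
  let bP := Module.finBasis ℚ ↥(V ⊔ W)
  let w : Fin p → ℂ := fun i => (bP i : ℂ)
  have hw_li : LinearIndependent ℚ w := bP.linearIndependent.map' (V ⊔ W).subtype (Submodule.ker_subtype _)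
  have hw_mem : ∀ i, w i ∈ Submodule.span ℚ (Set.range s) := fun i => by rw [hP]; exact (bP i).2
  let bU := Module.finBasis ℚ ↥(V ⊓ W)
  let u : Fin k → ℂ := fun i => (bU i : ℂ)
  have hu_li : LinearIndependent ℚ u := bU.linearIndependent.map' (V ⊓ W).subtype (Submodule.ker_subtype _)
  have hu_mem : ∀ i, u i ∈ V ⊓ W := fun i => (bU i).2
  -- clear denominators
  choose Nw hNw hNw_mem using fun i => exists_nsmul_mem_span_int s (hw_mem i)
  choose N₁ hN₁ hN₁_mem using fun i => exists_nsmul_mem_span_int z (hu_mem i).1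
  choose N₂ hN₂ hN₂_mem using fun i => exists_nsmul_mem_span_int y (hu_mem i).2
  let w' : Fin p → ℂ := fun i => (Nw i : ℚ) • w i
  let u' : Fin k → ℂ := fun i => ((N₁ i * N₂ i : ℕ) : ℚ) • u i
  have hw'li : LinearIndependent ℚ w' := by
    let cw : Fin p → ℚˣ := fun i => Units.mk0 (Nw i : ℚ) (Nat.cast_ne_zero.mpr (hNw i))
    have he : cw • w = w' := by
      funext i; simp only [Pi.smul_apply', cw, w', Units.smul_def, Units.val_mk0]
    exact he ▸ hw_li.units_smul cw
  have hu'li : LinearIndependent ℚ u' := by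
    let cu : Fin k → ℚˣ := fun i => Units.mk0 ((N₁ i * N₂ i : ℕ) : ℚ)
      (Nat.cast_ne_zero.mpr (mul_ne_zero (hN₁ i) (hN₂ i)))
    have he : cu • u = u' := by
      funext i; simp only [Pi.smul_apply', cu, u', Units.smul_def, Units.val_mk0]
    exact he ▸ hu_li.units_smul cu
  have hu'_memz : ∀ i, u' i ∈ Submodule.span ℤ (Set.range z) := by
    intro i
    have : u' i = (N₂ i : ℤ) • ((N₁ i : ℚ) • u i) := by
      show ((N₁ i * N₂ i : ℕ) : ℚ) • u i = _
      rw [← Int.cast_smul_eq_zsmul ℚ, smul_smul]; push_cast; ring_nf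
    rw [this]; exact Submodule.smul_mem _ _ (hN₁_mem i)
  have hu'_memy : ∀ i, u' i ∈ Submodule.span ℤ (Set.range y) := by
    intro i
    have : u' i = (N₁ i : ℤ) • ((N₂ i : ℚ) • u i) := by
      show ((N₁ i * N₂ i : ℕ) : ℚ) • u i = _
      rw [← Int.cast_smul_eq_zsmul ℚ, smul_smul]; push_cast; ring_nf
    rw [this]; exact Submodule.smul_mem _ _ (hN₂_mem i)
  have hu'_memV : ∀ i, u' i ∈ Submodule.span ℚ (Set.range z) := fun i =>
    Submodule.smul_mem _ _ (hu_mem i).1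
  -- the fields
  set Sz : Set ℂ := Set.range z ∪ Set.range (Complex.exp ∘ z) with hSz
  set Sy : Set ℂ := Set.range y ∪ Set.range (Complex.exp ∘ y) with hSy
  set Fz : IntermediateField ℚ ℂ := adjoin ℚ Sz with hFz
  set Fy : IntermediateField ℚ ℂ := adjoin ℚ Sy with hFy
  set F : IntermediateField ℚ ℂ := adjoin ℚ (Set.range s ∪ Set.range (Complex.exp ∘ s)) with hF
  set Fw : IntermediateField ℚ ℂ := adjoin ℚ (Set.range w' ∪ Set.range (Complex.exp ∘ w')) with hFw
  set Fu : IntermediateField ℚ ℂ := adjoin ℚ (Set.range u' ∪ Set.range (Complex.exp ∘ u')) with hFu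
  -- the two counts: `B` on the big space, span-minimality of the atom on the small one
  have hp : (p : Cardinal) ≤ Algebra.trdeg ℚ Fw + 1 := hD p w' hw'li
  have hk : (k : Cardinal) ≤ Algebra.trdeg ℚ Fu := hmin k hk_lt u' hu'li hu'_memV
  -- inclusions of fields
  have hFwF : Fw ≤ F := by
    rw [hFw, adjoin_le_iff]
    rintro a (⟨i, rfl⟩ | ⟨i, rfl⟩)
    · exact (mem_adjoin_of_mem_span_int s (hNw_mem i)).1
    · exact (mem_adjoin_of_mem_span_int s (hNw_mem i)).2
  have hFuFz : Fu ≤ Fz := by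
    rw [hFu, adjoin_le_iff]
    rintro a (⟨i, rfl⟩ | ⟨i, rfl⟩)
    · exact (mem_adjoin_of_mem_span_int z (hu'_memz i)).1
    · exact (mem_adjoin_of_mem_span_int z (hu'_memz i)).2
  have hFuFy : Fu ≤ Fy := by
    rw [hFu, adjoin_le_iff]
    rintro a (⟨i, rfl⟩ | ⟨i, rfl⟩)
    · exact (mem_adjoin_of_mem_span_int y (hu'_memy i)).1
    · exact (mem_adjoin_of_mem_span_int y (hu'_memy i)).2
  -- (a) `F = ℚ(Sy ∪ Sz)`
  have hF_eq : F = adjoin ℚ (Sy ∪ Sz) := by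
    apply le_antisymm
    · rw [hF, adjoin_le_iff]
      rintro a (⟨j | j, rfl⟩ | ⟨j | j, rfl⟩)
      · exact subset_adjoin ℚ _ (Or.inr (Or.inl ⟨j, rfl⟩))
      · exact subset_adjoin ℚ _ (Or.inl (Or.inl ⟨j, rfl⟩))
      · exact subset_adjoin ℚ _ (Or.inr (Or.inr ⟨j, rfl⟩))
      · exact subset_adjoin ℚ _ (Or.inl (Or.inr ⟨j, rfl⟩))
    · rw [adjoin_le_iff]
      rintro a ((⟨j, rfl⟩ | ⟨j, rfl⟩) | (⟨j, rfl⟩ | ⟨j, rfl⟩))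
      · exact subset_adjoin ℚ _ (Or.inl ⟨Sum.inr j, rfl⟩)
      · exact subset_adjoin ℚ _ (Or.inr ⟨Sum.inr j, rfl⟩)
      · exact subset_adjoin ℚ _ (Or.inl ⟨Sum.inl j, rfl⟩)
      · exact subset_adjoin ℚ _ (Or.inr ⟨Sum.inl j, rfl⟩)
  -- (b) tower over `Fy`
  have htower1 : Algebra.trdeg ℚ Fy + Algebra.trdeg Fy (adjoin Fy Sz) = Algebra.trdeg ℚ (adjoin ℚ (Sy ∪ Sz)) :=
    le_antisymm (trdeg_adjoin_sum_le_union (K := ℚ) Sy Sz) (trdeg_adjoin_union_le_sum (K := ℚ) Sy Sz)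
  -- (c) base change `Fu ≤ Fy` and the tower over `Fu`, whose top is `Fz`
  have hbase : Algebra.trdeg Fy (adjoin Fy Sz) ≤ Algebra.trdeg Fu (adjoin Fu Sz) :=
    trdeg_adjoin_le_of_le hFuFy Sz
  have htower2 : Algebra.trdeg ℚ Fu + Algebra.trdeg Fu (adjoin Fu Sz) = Algebra.trdeg ℚ Fz := by
    have h3 : adjoin ℚ ((Set.range u' ∪ Set.range (Complex.exp ∘ u')) ∪ Sz) = Fz := by
      apply le_antisymm
      · rw [adjoin_le_iff]
        rintro a (ha | ha)
        · exact hFuFz (subset_adjoin ℚ _ ha)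
        · exact subset_adjoin ℚ _ ha
      · exact adjoin.mono ℚ _ _ Set.subset_union_right
    have h12 := le_antisymm (trdeg_adjoin_sum_le_union (K := ℚ) (Set.range u' ∪ Set.range (Complex.exp ∘ u')) Sz)
      (trdeg_adjoin_union_le_sum (K := ℚ) (Set.range u' ∪ Set.range (Complex.exp ∘ u')) Sz)
    rw [h3] at h12
    exact h12
  -- (d) assemble: n + m = p + k ≤ (trdeg Fw + 1) + trdeg Fu ≤ … ≤ trdeg Fy + trdeg Fz + 1
  have hFwF' : Algebra.trdeg ℚ Fw ≤ Algebra.trdeg ℚ F :=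
    trdeg_le_of_injective (inclusion hFwF) (inclusion_injective hFwF)
  have hsum : ((n + m : ℕ) : Cardinal) ≤ Algebra.trdeg ℚ Fy + Algebra.trdeg ℚ Fz + 1 := by
    calc ((n + m : ℕ) : Cardinal) = ((p + k : ℕ) : Cardinal) := by rw [hcount]
      _ = (p : Cardinal) + (k : Cardinal) := by rw [Nat.cast_add]
      _ ≤ (Algebra.trdeg ℚ Fw + 1) + Algebra.trdeg ℚ Fu := add_le_add hp hk
      _ ≤ (Algebra.trdeg ℚ F + 1) + Algebra.trdeg ℚ Fu := add_le_add (add_le_add hFwF' (le_refl _)) (le_refl _)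
      _ = (Algebra.trdeg ℚ Fy + Algebra.trdeg Fy (adjoin Fy Sz)) + Algebra.trdeg ℚ Fu + 1 := by
            rw [htower1, hF_eq]; ring
      _ ≤ (Algebra.trdeg ℚ Fy + Algebra.trdeg Fu (adjoin Fu Sz)) + Algebra.trdeg ℚ Fu + 1 :=
            add_le_add (add_le_add (add_le_add (le_refl _) hbase) (le_refl _)) (le_refl _)
      _ = Algebra.trdeg ℚ Fy + (Algebra.trdeg ℚ Fu + Algebra.trdeg Fu (adjoin Fu Sz)) + 1 := by ring
      _ = Algebra.trdeg ℚ Fy + Algebra.trdeg ℚ Fz + 1 := by rw [htower2]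
  -- (e) both transcendence degrees are finite: count
  obtain ⟨t, ht⟩ := Cardinal.lt_aleph0.mp (hztr.trans (Cardinal.natCast_lt_aleph0 (n := n)))
  obtain ⟨t', ht'⟩ := Cardinal.lt_aleph0.mp (hytr.trans (Cardinal.natCast_lt_aleph0 (n := m)))
  have hztr' := hztr
  have hytr' := hytr
  rw [ht] at hsum hztr'
  rw [ht'] at hsum hytr'
  norm_cast at hsum hztr' hytr'
  omega

/-- **Uniqueness of the atom.**  Under `B`, two tight atoms span the same ℚ-subspace. -/
theorem atom_span_unique (hD : DefectOneSchanuel) {n m : ℕ} {z : Fin n → ℂ} {y : Fin m → ℂ}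
    (hz : LinearIndependent ℚ z)
    (hztr : Algebra.trdeg ℚ ↥(adjoin ℚ (Set.range z ∪ Set.range (Complex.exp ∘ z))) < (n : Cardinal))
    (hzmin : ∀ (k : ℕ), k < n → ∀ (w : Fin k → ℂ), LinearIndependent ℚ w →
      (∀ i, w i ∈ Submodule.span ℚ (Set.range z)) →
      (k : Cardinal) ≤ Algebra.trdeg ℚ ↥(adjoin ℚ (Set.range w ∪ Set.range (Complex.exp ∘ w))))
    (hy : LinearIndependent ℚ y)
    (hytr : Algebra.trdeg ℚ ↥(adjoin ℚ (Set.range y ∪ Set.range (Complex.exp ∘ y))) < (m : Cardinal))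
    (hymin : ∀ (k : ℕ), k < m → ∀ (w : Fin k → ℂ), LinearIndependent ℚ w →
      (∀ i, w i ∈ Submodule.span ℚ (Set.range y)) →
      (k : Cardinal) ≤ Algebra.trdeg ℚ ↥(adjoin ℚ (Set.range w ∪ Set.range (Complex.exp ∘ w)))) :
    Submodule.span ℚ (Set.range z) = Submodule.span ℚ (Set.range y) :=
  le_antisymm (span_le_of_atom_of_failure hD hz hztr hzmin hy hytr)
    (span_le_of_atom_of_failure hD hy hytr hymin hz hztr)

/-- **Conjugation rigidity.**  Under `B`, the span of a tight atom is conjugation-stable (the conjugate tuple is a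
failing ℚ-l.i. tuple of the same length, so the core lemma and a dimension count apply). -/
theorem conj_mem_span_of_atom (hD : DefectOneSchanuel) {n : ℕ} {z : Fin n → ℂ}
    (hz : LinearIndependent ℚ z)
    (hztr : Algebra.trdeg ℚ ↥(adjoin ℚ (Set.range z ∪ Set.range (Complex.exp ∘ z))) < (n : Cardinal))
    (hmin : ∀ (k : ℕ), k < n → ∀ (w : Fin k → ℂ), LinearIndependent ℚ w →
      (∀ i, w i ∈ Submodule.span ℚ (Set.range z)) →
      (k : Cardinal) ≤ Algebra.trdeg ℚ ↥(adjoin ℚ (Set.range w ∪ Set.range (Complex.exp ∘ w)))) :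
    ∀ i, (starRingEnd ℂ) (z i) ∈ Submodule.span ℚ (Set.range z) := by
  classical
  have hzc : LinearIndependent ℚ (fun j => conj (z j)) := linearIndependent_conj hz
  have hzctr : Algebra.trdeg ℚ ↥(adjoin ℚ (Set.range (fun j => conj (z j)) ∪
      Set.range (Complex.exp ∘ fun j => conj (z j)))) < (n : Cardinal) := by
    rw [trdeg_conj_eq z]; exact hztr
  have hle : Submodule.span ℚ (Set.range z) ≤ Submodule.span ℚ (Set.range fun j => conj (z j)) :=
    span_le_of_atom_of_failure hD hz hztr hmin hzc hzctr
  haveI : FiniteDimensional ℚ ↥(Submodule.span ℚ (Set.range fun j => conj (z j))) :=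
    FiniteDimensional.span_of_finite ℚ (Set.finite_range _)
  have heq : Submodule.span ℚ (Set.range z) = Submodule.span ℚ (Set.range fun j => conj (z j)) := by
    apply Submodule.eq_of_le_of_finrank_eq hle
    rw [finrank_span_eq_card hz, finrank_span_eq_card hzc]
  intro i
  rw [heq]
  exact Submodule.subset_span ⟨i, rfl⟩

/-! ## §4  The conjugation restriction of 30352 is free under `B` -/

/-- `B → (30352 restricted to conjugation-stable spans) → 30352`. -/
theorem entangled_of_conjStableRestricted (hD : DefectOneSchanuel)
    (hκ : ∀ (n : ℕ), 3 ≤ n → ∀ (z : Fin n → ℂ), LinearIndependent ℚ z → (∀ i, z i ∈ Literature.NumberTheory.Transcendental.ecl (∅ : Set ℂ)) → (∀ (m : ℕ), m < n → ∀ (w : Fin m → ℂ), LinearIndependent ℚ w → (∀ i, w i ∈ Submodule.span ℚ (Set.range z)) → (m : Cardinal) ≤ Algebra.trdeg ℚ ↥(IntermediateField.adjoin ℚ (Set.range w ∪ Set.range (Complex.exp ∘ w)))) → (∀ w : ℂ, IsAlgebraic ↥(IntermediateField.adjoin ℚ (Set.range z ∪ Set.range (Complex.exp ∘ z))) w → IsAlgebraic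 ↥(IntermediateField.adjoin ℚ (Set.range z ∪ Set.range (Complex.exp ∘ z))) (Complex.exp w) → w ∈ Submodule.span ℚ (Set.range z)) → (∀ (k : ℕ) (t : Fin k → ℂ) (β₀ γ₀ : Fin n → ℂ) (β γ : Fin n → Fin k → ℂ), (∀ i, IsAlgebraic ℚ (β₀ i)) → (∀ i j, IsAlgebraic ℚ (β i j)) → (∀ i, IsAlgebraic ℚ (γ₀ i)) → (∀ i j, IsAlgebraic ℚ (γ i j)) → (∀ i, z i = β₀ i + ∑ j, β i j * t j) → (∀ i, Complex.exp (z i) = γ₀ i + ∑ j, γ i j * t j) → n ≤ k) → (∀ (k : ℕ) (t : Fin k → ℂ) (β₀ γ₀ : Fin n → ℂ) (β γ : Fin n → Fin k → ℂ) (δ ε : Fin n → Fin k → Fin k → ℂ), (∀ i, IsAlgebraic ℚ (β₀ i)) → (∀ i j, IsAlgebraic ℚ (β i j)) → (∀ i j j', IsAlgebraic ℚ (δ i j j')) → (∀ i, IsAlgebraic ℚ (γ₀ i)) → (∀ i j, IsAlgebraic ℚ (γ i j)) → (∀ i j j', IsAlgebraic ℚ (ε i j j')) → (∀ i, z i = β₀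 i + ∑ j, β i j * t j + ∑ j, ∑ j', δ i j j' * (t j * t j')) → (∀ i, Complex.exp (z i) = γ₀ i + ∑ j, γ i j * t j + ∑ j, ∑ j', ε i j j' * (t j * t j')) → n ≤ k) → (∀ (k : ℕ) (t : Fin k → ℂ) (D : MvPolynomial (Fin k) ℂ) (N E : Fin n → MvPolynomial (Fin k) ℂ), (∀ m, IsAlgebraic ℚ (MvPolynomial.coeff m D)) → (∀ i m, IsAlgebraic ℚ (MvPolynomial.coeff m (N i))) → (∀ i m, IsAlgebraic ℚ (MvPolynomial.coeff m (E i))) → MvPolynomial.eval t D ≠ 0 → (∀ i, z i * MvPolynomial.eval t D = MvPolynomial.eval t (N i)) → (∀ i, Complex.exp (z i) * MvPolynomial.eval t D = MvPolynomial.eval t (E i)) → n ≤ k) → (Algebra.trdeg ℚ ↥(IntermediateField.adjoin ℚ (Set.range z ∪ Set.range (Complex.exp ∘ z))) < Algebra.trdeg ℚ ↥(IntermediateField.adjoin ℚ (Set.range z)) + Algebra.trdeg ℚ ↥(IntermediateField.adjoin ℚ (Set.range (Complex.exp ∘ z)))) → (∀ i, (starRingEnd ℂ) (z i) ∈ Submodule.span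 ℚ (Set.range z)) → (n : Cardinal) ≤ Algebra.trdeg ℚ ↥(IntermediateField.adjoin ℚ (Set.range z ∪ Set.range (Complex.exp ∘ z)))) :
    EntangledSaturatedEssentialSchanuel := by
  intro n hn z hz hecl hmin hsat hlin hquad hrat hent
  by_contra hlt
  have hlt' : Algebra.trdeg ℚ ↥(adjoin ℚ (Set.range z ∪ Set.range (Complex.exp ∘ z))) < (n : Cardinal) :=
    lt_of_not_ge hlt
  exact hlt (hκ n hn z hz hecl hmin hsat hlin hquad hrat hent (conj_mem_span_of_atom hD hz hlt' hmin))

end Summit.Schanuel.Schanuel.Theorems.RootDecomp1AtomRigidity
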